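import Literature.GroupTheory.ArithmeticGroups.IharaAmalgamPingPong
import Mathlib.GroupTheory.PushoutI
import HarnessLib

/-!
# Ihara's amalgam `Γ̃(N) = Γ(N) *_{Γ(N) ∩ Γ₀(p)} A⁻¹ Γ(N) A ≤ SL₂(ℤ[1/p])` — II: the universal property

Topic `Literature/GroupTheory/ArithmeticGroups`; namespace
`Literature.GroupTheory.ArithmeticGroups.IharaAmalgam`.  PROOF-ONLY sequel of
`IharaAmalgamPingPong.lean` (no definition, no named fact; D-0026).  From the ping-pong certificate
of file I (`prod_ne_one_of_reduced`: non-empty reduced alternating words in `K₀ = Γ(N)`,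
`K₁ = A⁻¹ Γ(N) A ≤ GL₂(ℚ)` are `≠ 1`, `p ∤ N` prime, `A = diag(p, 1)`) we derive the UNIVERSAL
PROPERTY of the subgroup `K₀ ⊔ K₁` generated by the two vertex groups: it is the free product of
`K₀` and `K₁` amalgamated over the edge group `K₀ ∩ K₁ = Γ(N) ∩ Γ₀(p)` [Serre, *Trees*, II.1.4
Theorem 3 / Corollary 1; Ihara 1966].

* `pushoutI_lift_injective` — for two subgroups `K false, K true ≤ Γ` with a ping-pong certificate,
  the canonical map from Mathlib's amalgamated product `Monoid.PushoutI` (of the two inclusions of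
  `K false ⊓ K true`) to `Γ` is injective: an element in the kernel has a normal form
  (`Monoid.PushoutI.NormalWord`) `head · g₁ ⋯ g_k` with letters in transversals of the edge group,
  and `(head g₁) g₂ ⋯ g_k` is a reduced alternating word with product `1`, so `k = 0`, `head = 1`
  [Serre1980Trees, I.1.2 Thm. 1; LyndonSchupp1977, IV.2];
* `exists_hom_sup_of_reduced` — hence (`Monoid.PushoutI.lift` transported along
  `MonoidHom.ofInjective`) homomorphisms `f b : K b → Δ` agreeing on the edge group extend to
  `K false ⊔ K true → Δ`;
* `exists_hom_sup` — **Ihara's theorem** for `K₀ = Γ(N)`, `K₁ = A⁻¹ Γ(N) A` in `GL₂(ℚ)` (vertex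
  groups in hypothesis form `hK₀`, `hK₁`, `hA`, as in file I).

Consumed by file III (`K₀ ⊔ K₁` is the level-`N` principal congruence subgroup of `SL₂(ℤ[1/p])`)
and by the K★ stub `stub_hker2` (CDT Lemma 4.4.1 / 4.6.2: amalgam + congruence subgroup property).

## References

* [Serre1980Trees] J.-P. Serre, *Trees*, Springer 1980, I.1.1–I.1.2 (amalgams, normal form Thm. 1),
  I.4.1 Thm. 6, II.1.4 Thm. 3 and Cor. 1.
* [Ihara1966DiscreteSubgroups] Y. Ihara, J. Math. Soc. Japan 18 (1966) 219–235, Thm. 1.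
* [LyndonSchupp1977] R. Lyndon, P. Schupp, *Combinatorial Group Theory*, IV.2 (Thm. 2.6).
-/

namespace Literature.GroupTheory.ArithmeticGroups

namespace IharaAmalgam

open scoped MatrixGroups
open Matrix.SpecialLinearGroup CongruenceSubgroup Monoid

/-! ### Abstract: a ping-pong certificate makes `K₀ ⊔ K₁` the amalgam -/

section Abstract

variable {Γ : Type*} [Group Γ] (K : Bool → Subgroup Γ)

/-- The evaluation of a word of the coproduct in `Γ` is the product of its letters. [folklore] -/
private lemma lift_ofCoprodI_prod (φ : ∀ b, ↥(K false ⊓ K true) →* ↥(K b))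
    (ε : PushoutI φ →* Γ) (hε : ∀ b (g : ↥(K b)), ε (PushoutI.of b g) = g) (w : CoprodI.Word (fun b ↦ ↥(K b))) :
    ε (PushoutI.ofCoprodI w.prod) = (w.toList.map fun x ↦ ((x.2 : ↥(K x.1)) : Γ)).prod := by
  rw [CoprodI.Word.prod, map_list_prod, map_list_prod, List.map_map, List.map_map]
  congr 1
  refine List.map_congr_left fun x _ ↦ ?_
  simp [hε]

/-- **Reduced words detect the amalgam.** If every non-empty reduced alternating word in
`K false, K true ≤ Γ` has product `≠ 1`, then the canonical map from the amalgamated free product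
`K false *_{K false ⊓ K true} K true` (Mathlib's `Monoid.PushoutI` of the two inclusions) to `Γ` is
injective. [cite: Serre1980Trees, I.1.2 Thm. 1 and I.4.1 Thm. 6; LyndonSchupp1977, IV.2 Thm. 2.6] -/
theorem pushoutI_lift_injective
    (hred : ∀ l : List (Bool × Γ), l ≠ [] → (∀ x ∈ l, x.2 ∈ K x.1 ∧ x.2 ∉ K (!x.1)) →
      l.IsChain (fun x y ↦ x.1 ≠ y.1) → (l.map Prod.snd).prod ≠ 1)
    (φ : ∀ b, ↥(K false ⊓ K true) →* ↥(K b))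
    (hφ : ∀ b (h : ↥(K false ⊓ K true)), ((φ b h : ↥(K b)) : Γ) = h)
    (ε : PushoutI φ →* Γ) (hε : ∀ b (g : ↥(K b)), ε (PushoutI.of b g) = g) :
    Function.Injective ε := by
  classical
  have hφinj : ∀ b, Function.Injective (φ b) := fun b x y hxy ↦ by
    apply Subtype.ext
    rw [← hφ b x, ← hφ b y, hxy]
  obtain ⟨d⟩ := PushoutI.NormalWord.transversal_nonempty φ hφinj
  have hεbase : ∀ h : ↥(K false ⊓ K true), ε (PushoutI.base φ h) = h := fun h ↦ by
    rw [← PushoutI.of_apply_eq_base φ false, hε, hφ]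
  rw [injective_iff_map_eq_one]
  intro g hg
  -- normal form `g = base(head) · letters`
  let w : PushoutI.NormalWord d := g • PushoutI.NormalWord.empty
  have hgw : w.prod = g := by
    simp [w, PushoutI.NormalWord.prod_smul, PushoutI.NormalWord.prod_empty]
  have hεg : ε g = (w.head : Γ) * (w.toList.map fun x ↦ ((x.2 : ↥(K x.1)) : Γ)).prod := by
    rw [← hgw, PushoutI.NormalWord.prod, map_mul, hεbase, lift_ofCoprodI_prod K φ ε hε]
  -- letters of a normal word lie outside the edge group
  have hletter : ∀ x ∈ w.toList, ((x.2 : ↥(K x.1)) : Γ) ∉ K (!x.1) := by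
    intro x hx hx'
    have hx1 : ((x.2 : ↥(K x.1)) : Γ) ∈ K false ⊓ K true := by
      obtain ⟨i, xi⟩ := x
      cases i
      · exact ⟨xi.2, hx'⟩
      · exact ⟨hx', xi.2⟩
    -- so `x.2 ∈ range (φ x.1) ∩ d.set x.1 = {1}`
    have hrange : (x.2 : ↥(K x.1)) ∈ (φ x.1).range :=
      ⟨⟨_, hx1⟩, Subtype.ext (hφ x.1 _)⟩
    have hset : (x.2 : ↥(K x.1)) ∈ d.set x.1 := w.normalized x.1 x.2 (by simpa using hx)
    have hone : (x.2 : ↥(K x.1)) = 1 := by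
      obtain ⟨y, -, hy⟩ := (d.compl x.1).existsUnique (x.2 : ↥(K x.1))
      have h₁ := hy ⟨⟨x.2, hrange⟩, ⟨1, d.one_mem x.1⟩⟩ (mul_one _)
      have h₂ := hy ⟨⟨1, (φ x.1).range.one_mem⟩, ⟨x.2, hset⟩⟩ (one_mul _)
      have := congrArg (fun z : ((φ x.1).range) × (d.set x.1) ↦ (z.2 : ↥(K x.1))) (h₁.trans h₂.symm)
      simpa using this.symm
    exact w.ne_one x hx hone
  -- if there are letters, ping-pong contradicts `ε g = 1`
  rcases hw : w.toList with _ | ⟨x, rest⟩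
  · rw [hw, List.map_nil, List.prod_nil, mul_one] at hεg
    have hhead : w.head = 1 := by
      apply Subtype.ext
      simpa [hg] using hεg.symm
    rw [← hgw, PushoutI.NormalWord.prod]
    have hwempty : w.toWord.prod = 1 := by
      simp [CoprodI.Word.prod, hw]
    rw [hwempty, map_one, mul_one, hhead, map_one]
  · exfalso
    let L : List (Bool × Γ) := (x.1, (w.head : Γ) * ((x.2 : ↥(K x.1)) : Γ)) ::
      rest.map fun y ↦ (y.1, ((y.2 : ↥(K y.1)) : Γ))
    refine hred L (List.cons_ne_nil _ _) ?_ ?_ ?_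
    · intro y hy
      simp only [L, List.mem_cons, List.mem_map] at hy
      rcases hy with rfl | ⟨y', hy', rfl⟩
      · have hxmem : x ∈ w.toList := by rw [hw]; exact List.mem_cons_self
        have hh : (w.head : Γ) ∈ K x.1 := by
          cases x.1
          · exact w.head.2.1
          · exact w.head.2.2
        refine ⟨(K x.1).mul_mem hh (x.2).2, fun h' ↦ hletter x hxmem ?_⟩
        have hh' : (w.head : Γ) ∈ K (!x.1) := by
          cases x.1
          · exact w.head.2.2
          · exact w.head.2.1
        simpa using (K (!x.1)).mul_mem ((K (!x.1)).inv_mem hh') h'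
      · have hymem : y' ∈ w.toList := by rw [hw]; exact List.mem_cons_of_mem _ hy'
        exact ⟨(y'.2).2, hletter y' hymem⟩
    · have hch := w.chain_ne
      rw [hw] at hch
      simp only [L]
      rw [List.isChain_cons]
      refine ⟨?_, ?_⟩
      · intro y hy
        rcases rest with _ | ⟨y₀, rest'⟩
        · simp at hy
        · have : y = (y₀.1, ((y₀.2 : ↥(K y₀.1)) : Γ)) := by simpa using hy.symm
          subst this
          exact (List.isChain_cons_cons.mp hch).1
      · exact List.isChain_map_of_isChain (fun y : (Σ i, ↥(K i)) ↦ (y.1, ((y.2 : ↥(K y.1)) : Γ)))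
          (fun a b h ↦ h) hch.tail
    · rw [hg] at hεg
      simp only [L, List.map_cons, List.map_map, List.prod_cons]
      rw [hεg, mul_assoc, hw]
      simp only [List.map_cons, List.prod_cons, Function.comp_def]

/-- **Universal property of `K₀ ⊔ K₁` from a ping-pong certificate.** If every non-empty reduced
alternating word in `K false, K true ≤ Γ` has product `≠ 1`, then `K false ⊔ K true` is the free
product of `K false` and `K true` amalgamated over `K false ⊓ K true`: any two homomorphisms
`f b : K b → Δ` agreeing on `K false ⊓ K true` extend (uniquely) to `K false ⊔ K true → Δ`.
[cite: Serre1980Trees, I.1.1 (definition of the amalgam by its universal property) and I.4.1 Thm. 6] -/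
theorem exists_hom_sup_of_reduced
    (hred : ∀ l : List (Bool × Γ), l ≠ [] → (∀ x ∈ l, x.2 ∈ K x.1 ∧ x.2 ∉ K (!x.1)) →
      l.IsChain (fun x y ↦ x.1 ≠ y.1) → (l.map Prod.snd).prod ≠ 1)
    {Δ : Type*} [Group Δ] (f : ∀ b, ↥(K b) →* Δ)
    (hf : ∀ (g : Γ) (h₀ : g ∈ K false) (h₁ : g ∈ K true), f false ⟨g, h₀⟩ = f true ⟨g, h₁⟩) :
    ∃ F : ↥(K false ⊔ K true) →* Δ,
      ∀ b (g : Γ) (hg : g ∈ K b) (hg' : g ∈ K false ⊔ K true), F ⟨g, hg'⟩ = f b ⟨g, hg⟩ := by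
  classical
  -- the amalgam of the two inclusions of the edge group
  have hle : ∀ b, K false ⊓ K true ≤ K b := by
    rintro (_ | _)
    · exact inf_le_left
    · exact inf_le_right
  let φ : ∀ b, ↥(K false ⊓ K true) →* ↥(K b) := fun b ↦ Subgroup.inclusion (hle b)
  have hφ : ∀ b (h : ↥(K false ⊓ K true)), ((φ b h : ↥(K b)) : Γ) = h := fun _ _ ↦ rfl
  let ε : PushoutI φ →* Γ :=
    PushoutI.lift (fun b ↦ (K b).subtype) (K false ⊓ K true).subtype (fun b ↦ by ext; rfl)
  have hε : ∀ b (g : ↥(K b)), ε (PushoutI.of b g) = g := fun b g ↦ by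
    simp [ε, PushoutI.lift_of]
  have hinj : Function.Injective ε := pushoutI_lift_injective K hred φ hφ ε hε
  -- the glued homomorphism on the amalgam
  let Fhat : PushoutI φ →* Δ :=
    PushoutI.lift f ((f false).comp (Subgroup.inclusion inf_le_left)) (fun b ↦ by
      cases b
      · rfl
      · ext x
        exact (hf x.1 x.2.1 x.2.2).symm)
  have hFhat : ∀ b (g : ↥(K b)), Fhat (PushoutI.of b g) = f b g := fun b g ↦ by
    simp [Fhat, PushoutI.lift_of]
  -- `K false ⊔ K true ≤ range ε ≅ PushoutI φ`
  let e : PushoutI φ ≃* ε.range := MonoidHom.ofInjective hinj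
  have hmem : ∀ b (g : Γ) (hg : g ∈ K b), g ∈ ε.range := fun b g hg ↦
    ⟨PushoutI.of b ⟨g, hg⟩, hε b ⟨g, hg⟩⟩
  have hsup : K false ⊔ K true ≤ ε.range :=
    sup_le (fun g hg ↦ hmem false g hg) (fun g hg ↦ hmem true g hg)
  have hesymm : ∀ b (g : Γ) (hg : g ∈ K b), e.symm ⟨g, hmem b g hg⟩ = PushoutI.of b ⟨g, hg⟩ := by
    intro b g hg
    rw [MulEquiv.symm_apply_eq]
    apply Subtype.ext
    simp [e, MonoidHom.ofInjective_apply, hε]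
  refine ⟨Fhat.comp (e.symm.toMonoidHom.comp (Subgroup.inclusion hsup)), fun b g hg hg' ↦ ?_⟩
  have : Subgroup.inclusion hsup ⟨g, hg'⟩ = ⟨g, hmem b g hg⟩ := rfl
  simp only [MonoidHom.coe_comp, MulEquiv.coe_toMonoidHom, Function.comp_apply, this]
  rw [hesymm, hFhat]

end Abstract

/-! ### Ihara's theorem: `⟨Γ(N), A⁻¹ Γ(N) A⟩ ≅ Γ(N) *_{Γ(N) ∩ Γ₀(p)} A⁻¹ Γ(N) A` -/

section Concrete

variable {N p : ℕ} {A : GL (Fin 2) ℚ} {K₀ K₁ : Subgroup (GL (Fin 2) ℚ)}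

/-- **Ihara's theorem (universal property form).** For a prime `p ∤ N` and `A = diag(p, 1)`, the
subgroup of `GL₂(ℚ)` generated by `K₀ = Γ(N)` and `K₁ = A⁻¹ Γ(N) A` is their free product amalgamated
over `K₀ ∩ K₁ = Γ(N) ∩ Γ₀(p)`: two homomorphisms `f₀ : K₀ → Δ`, `f₁ : K₁ → Δ` that agree on
`K₀ ∩ K₁` have a common extension to `K₀ ⊔ K₁`. (By file III, `K₀ ⊔ K₁` is the principal congruence
subgroup of level `N` of `SL₂(ℤ[1/p])`.) [cite: Serre1980Trees, II.1.4 Thm. 3 and Cor. 1]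
[cite: Ihara1966DiscreteSubgroups, Thm. 1] -/
theorem exists_hom_sup [Fact p.Prime] (hNp : N.Coprime p)
    (hA : (A : Matrix (Fin 2) (Fin 2) ℚ) = !![(p : ℚ), 0; 0, 1])
    (hK₀ : ∀ g, g ∈ K₀ ↔ ∃ γ ∈ Gamma N, mapGL ℚ γ = g) (hK₁ : ∀ g, g ∈ K₁ ↔ A * g * A⁻¹ ∈ K₀)
    {Δ : Type*} [Group Δ] (f₀ : ↥K₀ →* Δ) (f₁ : ↥K₁ →* Δ)
    (hf : ∀ (g : GL (Fin 2) ℚ) (h₀ : g ∈ K₀) (h₁ : g ∈ K₁), f₀ ⟨g, h₀⟩ = f₁ ⟨g, h₁⟩) :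
    ∃ F : ↥(K₀ ⊔ K₁) →* Δ, (∀ g (hg : g ∈ K₀) (hg' : g ∈ K₀ ⊔ K₁), F ⟨g, hg'⟩ = f₀ ⟨g, hg⟩) ∧
      (∀ g (hg : g ∈ K₁) (hg' : g ∈ K₀ ⊔ K₁), F ⟨g, hg'⟩ = f₁ ⟨g, hg⟩) := by
  let K : Bool → Subgroup (GL (Fin 2) ℚ) := fun b ↦ cond b K₁ K₀
  let f : ∀ b, ↥(K b) →* Δ := fun b ↦ match b with
    | false => f₀
    | true => f₁
  have hred : ∀ l : List (Bool × GL (Fin 2) ℚ), l ≠ [] → (∀ x ∈ l, x.2 ∈ K x.1 ∧ x.2 ∉ K (!x.1)) →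
      l.IsChain (fun x y ↦ x.1 ≠ y.1) → (l.map Prod.snd).prod ≠ 1 := by
    intro l hl hK hc
    refine prod_ne_one_of_reduced hNp hA hK₀ hK₁ l hl (fun x hx ↦ ?_) hc
    obtain ⟨h1, h2⟩ := hK x hx
    obtain ⟨b, g⟩ := x
    cases b
    · exact ⟨h1, h2⟩
    · exact ⟨h1, h2⟩
  obtain ⟨F, hF⟩ := exists_hom_sup_of_reduced K hred f (fun g h₀ h₁ ↦ hf g h₀ h₁)
  exact ⟨F, fun g hg hg' ↦ hF false g hg hg', fun g hg hg' ↦ hF true g hg hg'⟩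

end Concrete

end IharaAmalgam

end Literature.GroupTheory.ArithmeticGroups
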